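import Summits.CriticalPhenomena.CardyFormulaZ2.Theorems.CardySusyWardParafermionFamiliesToSLESixSCRigidityC

/-!
# Schwarz–Christoffel rigidity on the strip with monotone traces (stub `stub_scRigidity`)

Theorems file for the crux `CardySusyWard.ParafermionFamiliesToSLESix` (stmt-CriticalPhenomena-10814),
line `exact-potential-schwarz-christoffel`: `scRigidity_unfolded` is LITERALLY the skeleton's
`SCRigidity` (reshape r2) with its local vocabulary `stripOpen / stripClosed / SameSegment / IsSCTrace`
unfolded, so that `theorem stub_scRigidity : SCRigidity := scRigidity_unfolded` closes the stub.

**Theorem** (`scRigidity_unfolded`).  Let `g, h` be bounded holomorphic functions on the strip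
`S = {0 < im w < 1}`, continuous on the closed strip, whose traces on every breakpoint-free segment of
the bottom line (breakpoints `B₀`) and of the top line (breakpoints `B₁`) move monotonically along the
lines `e^{iθ₀} ℝ`, `e^{iθ₁} ℝ` of the same piecewise-constant directions.  Assume `g′ ≠ 0` in `S`,
`|g′|` bounded below near every non-breakpoint boundary point, `g′ = (w - b)^{-β} ψ` (`β ∈ (-1,1)`,
`ψ(b) ≠ 0` holomorphic) at the breakpoints, and `|g′| ≥ c e^{-ν |re w|}` with `ν ≤ π` at both ends.
Then `h = c g + k` on the closed strip for some real `c ≥ 0` and `k ∈ ℂ`.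

Proof.  `Q := h′/g′` is holomorphic on `S`; by parts I–III it has non-negative real limits at every
point of the bottom line, and — applied to the pair reflected by `w ↦ conj w + i`, whose hypotheses are
supplied by `scBound_top`, `lowerBound_conjTop`, `trace_conjTop` — at every point of the top line; so
`Q` extends continuously to the closed strip (`continuousOn_extendFrom`).  Far out `|h′| ≤ 8M` (Cauchy)
and `|g′| ≥ c₀ e^{-π|re w|}`, so the extension is `O(e^{π |re w|})`, and the strip rigidity theorem
`Literature.Analysis.Complex.strip_rigidity_of_nonneg_boundary_values` (exponential type `π < 2π`,
non-negative values on both lines) makes it a constant `c ≥ 0`.  Finally `h′ = c g′` integrates on the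
convex open strip (`IsOpen.exists_eq_add_of_deriv_eq`) and passes to the closure by continuity.
The previous stub worker's counterexample `h′/g′ = (e^{πw} - 1)^{-2}` (double zero of `g′` at a
non-breakpoint boundary point) is excluded exactly by the lower bound on `|g′|` near regular points.
-/

noncomputable section

namespace Summit.CriticalPhenomena.CardyFormulaZ2.Theorems.ParafermionFamiliesToSLESix.SCRigidity

open Complex Set Filter Metric Topology
open scoped ComplexConjugate Real

/-! ### Schwarz–Christoffel local forms and the transported data -/

/-- A holomorphic `ψ` with `ψ c ≠ 0` is bounded away from `0` near `c`. [folklore] -/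
theorem exists_norm_lower {ψ : ℂ → ℂ} {c : ℂ} {r : ℝ} (hr : 0 < r)
    (hψ : DifferentiableOn ℂ ψ (ball c r)) (h0 : ψ c ≠ 0) :
    ∃ m > (0 : ℝ), ∃ r' > (0 : ℝ), r' ≤ r ∧ ∀ z ∈ ball c r', m ≤ ‖ψ z‖ := by
  have hc : ContinuousAt ψ c := (hψ.differentiableAt (ball_mem_nhds c hr)).continuousAt
  have hpos : 0 < ‖ψ c‖ / 2 := half_pos (norm_pos_iff.mpr h0)
  obtain ⟨δ, hδ, hδ'⟩ := Metric.continuousAt_iff.mp hc (‖ψ c‖ / 2) hpos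
  refine ⟨‖ψ c‖ / 2, hpos, min δ r, lt_min hδ hr, min_le_right _ _, fun z hz => ?_⟩
  have h1 : dist (ψ z) (ψ c) < ‖ψ c‖ / 2 := hδ' (ball_subset_ball (min_le_left _ _) hz)
  rw [dist_eq_norm, norm_sub_rev] at h1
  have := norm_sub_norm_le (ψ c) (ψ z)
  linarith

/-- The Schwarz–Christoffel local form at a bottom breakpoint gives `m ≤ |w - b|^β |g′ w|`. [folklore] -/
theorem scBound_bottom {g : ℂ → ℂ} {B₀ : Finset ℝ}
    (hsc : ∀ b ∈ B₀, ∃ β : ℝ, -1 < β ∧ β < 1 ∧ ∃ r > (0 : ℝ), ∃ ψ : ℂ → ℂ,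
      DifferentiableOn ℂ ψ (ball (b : ℂ) r) ∧ ψ b ≠ 0 ∧
      ∀ w ∈ ball (b : ℂ) r ∩ {w : ℂ | 0 < w.im ∧ w.im < 1}, deriv g w = (w - b) ^ (-(β : ℂ)) * ψ w) :
    ∀ b ∈ B₀, ∃ β : ℝ, -1 < β ∧ ∃ m > (0 : ℝ), ∃ r > (0 : ℝ),
      ∀ w ∈ ball (b : ℂ) r ∩ {w : ℂ | 0 < w.im ∧ w.im < 1}, m ≤ ‖w - b‖ ^ β * ‖deriv g w‖ := by
  intro b hb
  obtain ⟨β, hβ, -, r, hr, ψ, hψ, hψ0, hform⟩ := hsc b hb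
  obtain ⟨m, hm, r', hr', hr'r, hlow⟩ := exists_norm_lower hr hψ hψ0
  refine ⟨β, hβ, m, hm, r', hr', fun w hw => ?_⟩
  have hwb : w - (b : ℂ) ≠ 0 := sub_ne_zero.mpr fun h => by
    have := hw.2.1
    rw [h, ofReal_im] at this
    exact lt_irrefl _ this
  have hpos : 0 < ‖w - (b : ℂ)‖ := norm_pos_iff.mpr hwb
  rw [hform w ⟨ball_subset_ball hr'r hw.1, hw.2⟩, norm_mul,
    show (-(β : ℂ)) = ((-β : ℝ) : ℂ) by push_cast; ring, norm_cpow_real, Real.rpow_neg hpos.le,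
    ← mul_assoc, mul_inv_cancel₀ (Real.rpow_pos_of_pos hpos β).ne', one_mul]
  exact hlow w hw.1

/-- The Schwarz–Christoffel local form at a top breakpoint of `g` gives the bottom bound
`m ≤ |w - b|^β |(conj ∘ g ∘ (conj · + i))′ w|`. [folklore] -/
theorem scBound_top {g : ℂ → ℂ} {B₁ : Finset ℝ}
    (hsc : ∀ b ∈ B₁, ∃ β : ℝ, -1 < β ∧ β < 1 ∧ ∃ r > (0 : ℝ), ∃ ψ : ℂ → ℂ,
      DifferentiableOn ℂ ψ (ball ((b : ℂ) + I) r) ∧ ψ ((b : ℂ) + I) ≠ 0 ∧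
      ∀ w ∈ ball ((b : ℂ) + I) r ∩ {w : ℂ | 0 < w.im ∧ w.im < 1},
        deriv g w = ((b : ℂ) + I - w) ^ (-(β : ℂ)) * ψ w) :
    ∀ b ∈ B₁, ∃ β : ℝ, -1 < β ∧ ∃ m > (0 : ℝ), ∃ r > (0 : ℝ),
      ∀ w ∈ ball (b : ℂ) r ∩ {w : ℂ | 0 < w.im ∧ w.im < 1},
        m ≤ ‖w - b‖ ^ β * ‖deriv (fun w => conj (g (conj w + I))) w‖ := by
  intro b hb
  obtain ⟨β, hβ, -, r, hr, ψ, hψ, hψ0, hform⟩ := hsc b hb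
  obtain ⟨m, hm, r', hr', hr'r, hlow⟩ := exists_norm_lower hr hψ hψ0
  refine ⟨β, hβ, m, hm, r', hr', fun w hw => ?_⟩
  have hwb : w - (b : ℂ) ≠ 0 := sub_ne_zero.mpr fun h => by
    have := hw.2.1
    rw [h, ofReal_im] at this
    exact lt_irrefl _ this
  have hpos : 0 < ‖w - (b : ℂ)‖ := norm_pos_iff.mpr hwb
  have hz : conj w + I ∈ ball ((b : ℂ) + I) r' := by
    rw [mem_ball, dist_add_right, ← conj_ofReal, dist_conj_conj]
    exact hw.1
  have hkey : (b : ℂ) + I - (conj w + I) = conj ((b : ℂ) - w) := by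
    rw [map_sub, conj_ofReal]
    ring
  rw [deriv_conjTop, norm_conj, hform _ ⟨ball_subset_ball hr'r hz, conjTop_mem hw.2⟩, norm_mul, hkey,
    show (-(β : ℂ)) = ((-β : ℝ) : ℂ) by push_cast; ring, norm_cpow_real, norm_conj,
    norm_sub_rev (b : ℂ) w, Real.rpow_neg hpos.le, ← mul_assoc, mul_inv_cancel₀ (Real.rpow_pos_of_pos hpos β).ne', one_mul]
  exact hlow _ hz

/-- Boundary limits at the top line from those of the reflected pair at the bottom line. [folklore] -/
theorem tendsto_top_of_conjTop {g h : ℂ → ℂ} {x : ℝ} {L : ℂ}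
    (ht : Tendsto (fun w => deriv (fun w => conj (h (conj w + I))) w /
        deriv (fun w => conj (g (conj w + I))) w)
      (𝓝[{w : ℂ | 0 < w.im ∧ w.im < 1}] (x : ℂ)) (𝓝 L)) :
    Tendsto (fun w => deriv h w / deriv g w)
      (𝓝[{w : ℂ | 0 < w.im ∧ w.im < 1}] ((x : ℂ) + I)) (𝓝 (conj L)) := by
  have hσc : Continuous fun w : ℂ => conj w + I := continuous_conj.add continuous_const
  have hσx : conj ((x : ℂ) + I) + I = x := by
    rw [map_add, conj_ofReal, conj_I, neg_add_cancel_right]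
  have hσ : Tendsto (fun w : ℂ => conj w + I) (𝓝[{w : ℂ | 0 < w.im ∧ w.im < 1}] ((x : ℂ) + I))
      (𝓝[{w : ℂ | 0 < w.im ∧ w.im < 1}] (x : ℂ)) := by
    have := (hσc.continuousWithinAt (s := {w : ℂ | 0 < w.im ∧ w.im < 1})
      (x := (x : ℂ) + I)).tendsto_nhdsWithin (fun w hw => conjTop_mem hw)
    rwa [hσx] at this
  have h2 := (continuous_conj.tendsto L).comp (ht.comp hσ)
  refine h2.congr (fun w => ?_)
  simp only [Function.comp_apply, deriv_conjTop, map_div₀, conj_conj, conjTop_conjTop]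

/-- **Far-field derivative bound in the upper half of the strip** (the lower-half bound for the
reflected function). [folklore] -/
theorem norm_deriv_le_far_top {θ₁ : ℝ → ℝ} {B₁ : Finset ℝ} {f : ℂ → ℂ} {M : ℝ}
    (hθ : ∀ x y : ℝ, (∀ b ∈ B₁, (x < b ↔ y < b)) → θ₁ x = θ₁ y)
    (hd : DifferentiableOn ℂ f {w : ℂ | 0 < w.im ∧ w.im < 1})
    (hc : ContinuousOn f {w : ℂ | 0 ≤ w.im ∧ w.im ≤ 1})
    (hM : ∀ w ∈ {w : ℂ | 0 ≤ w.im ∧ w.im ≤ 1}, ‖f w‖ ≤ M)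
    (htr : ∀ x y : ℝ, x ≤ y → (∀ b ∈ B₁, (x < b ↔ y < b)) →
      (exp (-(θ₁ x : ℂ) * I) * (f (y + I) - f (x + I))).im = 0 ∧
      0 ≤ (exp (-(θ₁ x : ℂ) * I) * (f (y + I) - f (x + I))).re)
    {w : ℂ} (hw1 : w.im < 1) (hw : 1 / 2 ≤ w.im) (hfar : ∀ b ∈ B₁, 1 ≤ |w.re - b|) :
    ‖deriv f w‖ ≤ 8 * M := by
  have hθ' : ∀ x y : ℝ, (∀ b ∈ B₁, (x < b ↔ y < b)) → (fun x => -θ₁ x) x = (fun x => -θ₁ x) y :=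
    fun x y hxy => by simp only [hθ x y hxy]
  have key := norm_deriv_le_far_bottom (θ₀ := fun x => -θ₁ x) (f := fun w => conj (f (conj w + I)))
    (w := conj w + I) hθ' (differentiableOn_conjTop hd) (continuousOn_conjTop hc) (norm_conjTop_le hM)
    (trace_conjTop htr) (by simp only [add_im, conj_im, I_im]; linarith)
    (by simp only [add_im, conj_im, I_im]; linarith) (by simpa using hfar)
  rwa [deriv_conjTop, norm_conj, conjTop_conjTop] at key

/-! ### Assembly: Schwarz–Christoffel rigidity on the strip -/

/-- **Schwarz–Christoffel rigidity with monotone traces (strip form with breakpoints)** — the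
statement `SCRigidity` of the skeleton `Cruxes/ParafermionFamiliesToSLESix/ExactPotentialSchwarzChristoffel`
with its local vocabulary (`stripOpen`, `stripClosed`, `SameSegment`, `IsSCTrace`) unfolded.  Two bounded
holomorphic functions `g, h` on the strip `{0 < im w < 1}`, continuous on the closed strip, whose traces
on each breakpoint-free segment of the two boundary lines move monotonically along lines of the same
piecewise-constant directions; `g′ ≠ 0` inside, `|g′|` bounded below near every non-breakpoint boundary
point, of Schwarz–Christoffel type `(w - b)^{-β} ψ`, `β ∈ (-1, 1)`, at the breakpoints, and with
`|g′| ≥ c e^{-ν |re w|}`, `ν ≤ π`, at the two ends.  Then `h = c g + k` on the closed strip with `c ≥ 0`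
real.  Proof: `Q = h′/g′` is holomorphic in the strip and has non-negative real boundary values on both
lines (`tendsto_div_bottom`, applied to `(g, h)` and to the pair reflected by `w ↦ conj w + i`); it is
`O(e^{π |re w|})` (Cauchy estimates `|h′| ≤ 8M` far out), so by the strip rigidity theorem
`Literature.Analysis.Complex.strip_rigidity_of_nonneg_boundary_values` (type `π < 2π`) `Q ≡ c ≥ 0`;
integrate `h′ = c g′` on the connected strip and pass to the closure. [folklore] -/
theorem scRigidity_unfolded :
    ∀ (θ₀ θ₁ : ℝ → ℝ) (B₀ B₁ : Finset ℝ) (g h : ℂ → ℂ),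
    (∀ x y : ℝ, (∀ b ∈ B₀, (x < b ↔ y < b)) → θ₀ x = θ₀ y) →
    (∀ x y : ℝ, (∀ b ∈ B₁, (x < b ↔ y < b)) → θ₁ x = θ₁ y) →
    (DifferentiableOn ℂ g {w : ℂ | 0 < w.im ∧ w.im < 1} ∧
      ContinuousOn g {w : ℂ | 0 ≤ w.im ∧ w.im ≤ 1} ∧
      (∃ M : ℝ, ∀ w ∈ {w : ℂ | 0 ≤ w.im ∧ w.im ≤ 1}, ‖g w‖ ≤ M) ∧
      (∀ x y : ℝ, x ≤ y → (∀ b ∈ B₀, (x < b ↔ y < b)) →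
        (Complex.exp (-(θ₀ x : ℂ) * Complex.I) * (g y - g x)).im = 0 ∧
        0 ≤ (Complex.exp (-(θ₀ x : ℂ) * Complex.I) * (g y - g x)).re) ∧
      (∀ x y : ℝ, x ≤ y → (∀ b ∈ B₁, (x < b ↔ y < b)) →
        (Complex.exp (-(θ₁ x : ℂ) * Complex.I) * (g (y + Complex.I) - g (x + Complex.I))).im = 0 ∧
        0 ≤ (Complex.exp (-(θ₁ x : ℂ) * Complex.I) *
          (g (y + Complex.I) - g (x + Complex.I))).re)) →
    (DifferentiableOn ℂ h {w : ℂ | 0 < w.im ∧ w.im < 1} ∧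
      ContinuousOn h {w : ℂ | 0 ≤ w.im ∧ w.im ≤ 1} ∧
      (∃ M : ℝ, ∀ w ∈ {w : ℂ | 0 ≤ w.im ∧ w.im ≤ 1}, ‖h w‖ ≤ M) ∧
      (∀ x y : ℝ, x ≤ y → (∀ b ∈ B₀, (x < b ↔ y < b)) →
        (Complex.exp (-(θ₀ x : ℂ) * Complex.I) * (h y - h x)).im = 0 ∧
        0 ≤ (Complex.exp (-(θ₀ x : ℂ) * Complex.I) * (h y - h x)).re) ∧
      (∀ x y : ℝ, x ≤ y → (∀ b ∈ B₁, (x < b ↔ y < b)) →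
        (Complex.exp (-(θ₁ x : ℂ) * Complex.I) * (h (y + Complex.I) - h (x + Complex.I))).im = 0 ∧
        0 ≤ (Complex.exp (-(θ₁ x : ℂ) * Complex.I) *
          (h (y + Complex.I) - h (x + Complex.I))).re)) →
    (∀ w ∈ {w : ℂ | 0 < w.im ∧ w.im < 1}, deriv g w ≠ 0) →
    (∀ x : ℝ, x ∉ B₀ → ∃ r > (0 : ℝ), ∃ c > (0 : ℝ),
      ∀ w ∈ Metric.ball (x : ℂ) r ∩ {w : ℂ | 0 < w.im ∧ w.im < 1}, c ≤ ‖deriv g w‖) →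
    (∀ x : ℝ, x ∉ B₁ → ∃ r > (0 : ℝ), ∃ c > (0 : ℝ),
      ∀ w ∈ Metric.ball ((x : ℂ) + Complex.I) r ∩ {w : ℂ | 0 < w.im ∧ w.im < 1}, c ≤ ‖deriv g w‖) →
    (∀ b ∈ B₀, ∃ β : ℝ, -1 < β ∧ β < 1 ∧ ∃ r > (0 : ℝ), ∃ ψ : ℂ → ℂ,
      DifferentiableOn ℂ ψ (Metric.ball (b : ℂ) r) ∧ ψ b ≠ 0 ∧
      ∀ w ∈ Metric.ball (b : ℂ) r ∩ {w : ℂ | 0 < w.im ∧ w.im < 1},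
        deriv g w = (w - b) ^ (-(β : ℂ)) * ψ w) →
    (∀ b ∈ B₁, ∃ β : ℝ, -1 < β ∧ β < 1 ∧ ∃ r > (0 : ℝ), ∃ ψ : ℂ → ℂ,
      DifferentiableOn ℂ ψ (Metric.ball ((b : ℂ) + Complex.I) r) ∧ ψ ((b : ℂ) + Complex.I) ≠ 0 ∧
      ∀ w ∈ Metric.ball ((b : ℂ) + Complex.I) r ∩ {w : ℂ | 0 < w.im ∧ w.im < 1},
        deriv g w = ((b : ℂ) + Complex.I - w) ^ (-(β : ℂ)) * ψ w) →
    (∃ ν ∈ Set.Ioc (0 : ℝ) Real.pi,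
      (∀ x : ℝ, (∀ b ∈ B₀, x < b) → (∀ b ∈ B₁, x < b) → ∃ n : ℤ, ν = θ₁ x - θ₀ x + n * Real.pi) ∧
      ∃ c > (0 : ℝ), ∃ R : ℝ, ∀ w ∈ {w : ℂ | 0 < w.im ∧ w.im < 1}, w.re ≤ -R →
        c * Real.exp (ν * w.re) ≤ ‖deriv g w‖) →
    (∃ ν ∈ Set.Ioc (0 : ℝ) Real.pi,
      (∀ x : ℝ, (∀ b ∈ B₀, b < x) → (∀ b ∈ B₁, b < x) → ∃ n : ℤ, ν = θ₀ x - θ₁ x + n * Real.pi) ∧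
      ∃ c > (0 : ℝ), ∃ R : ℝ, ∀ w ∈ {w : ℂ | 0 < w.im ∧ w.im < 1}, R ≤ w.re →
        c * Real.exp (-(ν * w.re)) ≤ ‖deriv g w‖) →
    ∃ c : ℝ, 0 ≤ c ∧ ∃ k : ℂ, ∀ w ∈ {w : ℂ | 0 ≤ w.im ∧ w.im ≤ 1}, h w = c * g w + k := by
  intro θ₀ θ₁ B₀ B₁ g h hθ₀ hθ₁ hg hh hg' hlow₀ hlow₁ hsc₀ hsc₁ hendL hendR
  obtain ⟨hgd, hgc, ⟨Mg, hgMg⟩, hgtr₀, hgtr₁⟩ := hg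
  obtain ⟨hhd, hhc, ⟨Mh, hhMh⟩, hhtr₀, hhtr₁⟩ := hh
  obtain ⟨ν₁, hν₁, -, c₁, hc₁, R₁, hR₁⟩ := hendL
  obtain ⟨ν₂, hν₂, -, c₂, hc₂, R₂, hR₂⟩ := hendR
  -- a common bound
  set M : ℝ := max Mg Mh with hM
  have hgM : ∀ w ∈ {w : ℂ | 0 ≤ w.im ∧ w.im ≤ 1}, ‖g w‖ ≤ M := fun w hw =>
    (hgMg w hw).trans (le_max_left _ _)
  have hhM : ∀ w ∈ {w : ℂ | 0 ≤ w.im ∧ w.im ≤ 1}, ‖h w‖ ≤ M := fun w hw =>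
    (hhMh w hw).trans (le_max_right _ _)
  have hM0 : 0 ≤ M := (norm_nonneg _).trans (hgM 0 (by simp))
  -- boundary values on the bottom line
  have hbot := tendsto_div_bottom hθ₀ hgd hgc hgM hhd hhc hhM hgtr₀ hhtr₀ hg' hlow₀ (scBound_bottom hsc₀)
  -- boundary values on the top line, through the symmetry `w ↦ conj w + i`
  have hθ₁' : ∀ x y : ℝ, (∀ b ∈ B₁, (x < b ↔ y < b)) → (fun x => -θ₁ x) x = (fun x => -θ₁ x) y :=
    fun x y hxy => by simp only [hθ₁ x y hxy]
  have hgσ' : ∀ w ∈ {w : ℂ | 0 < w.im ∧ w.im < 1}, deriv (fun w => conj (g (conj w + I))) w ≠ 0 := by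
    intro w hw
    rw [deriv_conjTop, map_ne_zero]
    exact hg' _ (conjTop_mem hw)
  have htop' := tendsto_div_bottom (θ₀ := fun x => -θ₁ x) (g := fun w => conj (g (conj w + I)))
    (h := fun w => conj (h (conj w + I))) hθ₁' (differentiableOn_conjTop hgd) (continuousOn_conjTop hgc)
    (norm_conjTop_le hgM) (differentiableOn_conjTop hhd) (continuousOn_conjTop hhc) (norm_conjTop_le hhM)
    (trace_conjTop hgtr₁) (trace_conjTop hhtr₁) hgσ' (lowerBound_conjTop hlow₁) (scBound_top hsc₁)
  have htop : ∀ x : ℝ, ∃ L : ℝ, 0 ≤ L ∧ Tendsto (fun w => deriv h w / deriv g w)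
      (𝓝[{w : ℂ | 0 < w.im ∧ w.im < 1}] ((x : ℂ) + I)) (𝓝 (L : ℂ)) := by
    intro x
    obtain ⟨L, hL0, hL⟩ := htop' x
    refine ⟨L, hL0, ?_⟩
    have := tendsto_top_of_conjTop hL
    rwa [conj_ofReal] at this
  -- the quotient `Q` and its continuous extension `u` to the closed strip
  set S : Set ℂ := {w : ℂ | 0 < w.im ∧ w.im < 1} with hS
  set Q : ℂ → ℂ := fun w => deriv h w / deriv g w with hQ
  have hQd : DifferentiableOn ℂ Q S := (hhd.deriv isOpen_strip).div (hgd.deriv isOpen_strip) hg'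
  set u : ℂ → ℂ := extendFrom S Q with hu
  have hclS : closure S = {w : ℂ | 0 ≤ w.im ∧ w.im ≤ 1} := closure_strip
  have hlimits : ∀ z ∈ {w : ℂ | 0 ≤ w.im ∧ w.im ≤ 1}, ∃ y, Tendsto Q (𝓝[S] z) (𝓝 y) := by
    intro z hz
    rcases hz.1.eq_or_lt with h0 | h0
    · have hz' : z = ((z.re : ℝ) : ℂ) := Complex.ext (by simp) (by simp [← h0])
      obtain ⟨L, -, hL⟩ := hbot z.re
      rw [hz']
      exact ⟨_, hL⟩
    rcases hz.2.lt_or_eq with h1 | h1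
    · exact ⟨Q z, ((hQd.differentiableAt (isOpen_strip.mem_nhds ⟨h0, h1⟩)).continuousAt.tendsto).mono_left
        nhdsWithin_le_nhds⟩
    · have hz' : z = ((z.re : ℝ) : ℂ) + I := Complex.ext (by simp) (by simp [h1])
      obtain ⟨L, -, hL⟩ := htop z.re
      rw [hz']
      exact ⟨_, hL⟩
  have huc : ContinuousOn u {w : ℂ | 0 ≤ w.im ∧ w.im ≤ 1} :=
    continuousOn_extendFrom (by rw [hclS]) hlimits
  have huQ : ∀ w ∈ S, u w = Q w := extendFrom_extends hQd.continuousOn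
  have hud : DifferentiableOn ℂ u S := hQd.congr huQ
  have hu0 : ∀ x : ℝ, ∃ r : ℝ, 0 ≤ r ∧ u x = r := by
    intro x
    obtain ⟨L, hL0, hL⟩ := hbot x
    exact ⟨L, hL0, extendFrom_eq (by rw [hclS]; simp) hL⟩
  have hu1 : ∀ x : ℝ, ∃ r : ℝ, 0 ≤ r ∧ u (x + I) = r := by
    intro x
    obtain ⟨L, hL0, hL⟩ := htop x
    exact ⟨L, hL0, extendFrom_eq (by rw [hclS]; simp) hL⟩
  -- growth at the two ends: `|h′| ≤ 8M`, `|g′| ≥ c₀ e^{-π |re w|}`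
  obtain ⟨Rb, hRb⟩ : ∃ Rb : ℝ, ∀ b ∈ B₀ ∪ B₁, |b| ≤ Rb := by
    obtain ⟨Rb, hRb⟩ := ((B₀ ∪ B₁).image fun b => |b|).bddAbove
    exact ⟨Rb, fun b hb => hRb (Finset.mem_coe.mpr (Finset.mem_image_of_mem _ hb))⟩
  set R₀ : ℝ := max (max R₁ R₂) (|Rb| + 1) with hR₀
  have hR₀0 : 0 ≤ R₀ := le_trans (by positivity) (le_max_right _ _)
  set c₀ : ℝ := min c₁ c₂ with hc₀
  have hc₀0 : 0 < c₀ := lt_min hc₁ hc₂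
  have hfar : ∀ w ∈ S, R₀ ≤ |w.re| → ‖Q w‖ ≤ 8 * M / c₀ * Real.exp (π * |w.re|) := by
    intro w hw hwR
    have hfarB : ∀ b ∈ B₀ ∪ B₁, 1 ≤ |w.re - b| := by
      intro b hb
      have h1 := hRb b hb
      have h2 : |Rb| + 1 ≤ |w.re| := (le_max_right _ _).trans hwR
      have h3 := abs_sub_abs_le_abs_sub w.re b
      linarith [le_abs_self Rb]
    have hh' : ‖deriv h w‖ ≤ 8 * M := by
      rcases le_or_gt w.im (1 / 2) with him | him
      · exact norm_deriv_le_far_bottom hθ₀ hhd hhc hhM hhtr₀ hw.1 him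
          (fun b hb => hfarB b (Finset.mem_union_left _ hb))
      · exact norm_deriv_le_far_top hθ₁ hhd hhc hhM hhtr₁ hw.2 him.le
          (fun b hb => hfarB b (Finset.mem_union_right _ hb))
    have hg'low : c₀ * Real.exp (-(π * |w.re|)) ≤ ‖deriv g w‖ := by
      have hR12 : max R₁ R₂ ≤ |w.re| := (le_max_left _ _).trans hwR
      rcases le_or_gt 0 w.re with hre | hre
      · rw [abs_of_nonneg hre] at hR12 ⊢
        have h1 := hR₂ w hw ((le_max_right _ _).trans hR12)
        calc c₀ * Real.exp (-(π * w.re)) ≤ c₂ * Real.exp (-(ν₂ * w.re)) := by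
              apply mul_le_mul (min_le_right _ _) _ (Real.exp_pos _).le hc₂.le
              exact Real.exp_le_exp.mpr (by nlinarith [hν₂.2, hν₂.1])
          _ ≤ ‖deriv g w‖ := h1
      · rw [abs_of_neg hre] at hR12 ⊢
        have h1 := hR₁ w hw (by linarith [(le_max_left _ _).trans hR12])
        calc c₀ * Real.exp (-(π * -w.re)) ≤ c₁ * Real.exp (ν₁ * w.re) := by
              apply mul_le_mul (min_le_left _ _) _ (Real.exp_pos _).le hc₁.le
              exact Real.exp_le_exp.mpr (by nlinarith [hν₁.2, hν₁.1])
          _ ≤ ‖deriv g w‖ := h1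
    have hgpos : 0 < ‖deriv g w‖ := norm_pos_iff.mpr (hg' w hw)
    rw [hQ]
    dsimp only
    rw [norm_div, div_le_iff₀ hgpos]
    calc ‖deriv h w‖ ≤ 8 * M := hh'
      _ = 8 * M / c₀ * Real.exp (π * |w.re|) * (c₀ * Real.exp (-(π * |w.re|))) := by
          rw [Real.exp_neg]; field_simp
      _ ≤ 8 * M / c₀ * Real.exp (π * |w.re|) * ‖deriv g w‖ := by
          apply mul_le_mul_of_nonneg_left hg'low
          positivity
  -- the bound on the closed strip
  have hfar' : ∀ z ∈ {w : ℂ | 0 ≤ w.im ∧ w.im ≤ 1}, R₀ < |z.re| →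
      ‖u z‖ ≤ 8 * M / c₀ * Real.exp (π * |z.re|) := by
    intro z hz hzR
    obtain ⟨y, hy⟩ := hlimits z hz
    have huz : u z = y := extendFrom_eq (by rw [hclS]; exact hz) hy
    haveI : (𝓝[S] z).NeBot := mem_closure_iff_nhdsWithin_neBot.mp (by rw [hclS]; exact hz)
    have hT : Tendsto (fun w => ‖Q w‖) (𝓝[S] z) (𝓝 ‖u z‖) := by rw [huz]; exact hy.norm
    have hG : Tendsto (fun w : ℂ => 8 * M / c₀ * Real.exp (π * |w.re|)) (𝓝[S] z)
        (𝓝 (8 * M / c₀ * Real.exp (π * |z.re|))) :=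
      ((by fun_prop : Continuous fun w : ℂ => 8 * M / c₀ * Real.exp (π * |w.re|)).tendsto z).mono_left
        nhdsWithin_le_nhds
    refine le_of_tendsto_of_tendsto hT hG ?_
    have hopen : IsOpen {w : ℂ | R₀ < |w.re|} := isOpen_lt continuous_const (continuous_abs.comp continuous_re)
    filter_upwards [mem_nhdsWithin_of_mem_nhds (hopen.mem_nhds hzR), self_mem_nhdsWithin] with w hw hwS
    exact hfar w hwS (le_of_lt hw)
  have hcpt : IsCompact (Icc (-R₀) R₀ ×ℂ Icc 0 1) :=
    Metric.isCompact_of_isClosed_isBounded (isClosed_Icc.reProdIm isClosed_Icc)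
      ((Metric.isBounded_Icc _ _).reProdIm (Metric.isBounded_Icc _ _))
  obtain ⟨K₀, hK₀⟩ := hcpt.exists_bound_of_continuousOn
    (huc.mono fun w hw => ⟨(mem_reProdIm.mp hw).2.1, (mem_reProdIm.mp hw).2.2⟩)
  set C : ℝ := max K₀ (8 * M / c₀) with hC
  have hK₀0 : 0 ≤ K₀ := (norm_nonneg _).trans (hK₀ 0 (by
    rw [mem_reProdIm]
    exact ⟨⟨by simp [hR₀0], by simp [hR₀0]⟩, by simp⟩))
  have hbound : ∀ w : ℂ, 0 ≤ w.im → w.im ≤ 1 → ‖u w‖ ≤ C * Real.exp (π * |w.re|) := by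
    intro w hw0 hw1
    have hexp : 1 ≤ Real.exp (π * |w.re|) := Real.one_le_exp (by positivity)
    rcases le_or_gt |w.re| R₀ with hR | hR
    · have h1 : ‖u w‖ ≤ K₀ := hK₀ w (by rw [mem_reProdIm]; exact ⟨abs_le.mp hR, hw0, hw1⟩)
      calc ‖u w‖ ≤ K₀ := h1
        _ ≤ C * 1 := by rw [mul_one]; exact le_max_left _ _
        _ ≤ C * Real.exp (π * |w.re|) :=
            mul_le_mul_of_nonneg_left hexp (hK₀0.trans (le_max_left _ _))
    · calc ‖u w‖ ≤ 8 * M / c₀ * Real.exp (π * |w.re|) := hfar' w ⟨hw0, hw1⟩ hR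
        _ ≤ C * Real.exp (π * |w.re|) := mul_le_mul_of_nonneg_right (le_max_right _ _) (by positivity)
  -- strip rigidity: `u ≡ c ≥ 0`
  obtain ⟨c, hc0, hc⟩ := Literature.Analysis.Complex.strip_rigidity_of_nonneg_boundary_values u C π
    (by linarith [Real.pi_pos]) hud huc hbound hu0 hu1
  -- integrate `h′ = c g′` on the (connected) open strip
  have hderiv : S.EqOn (deriv h) (deriv fun w => (c : ℂ) * g w) := by
    intro w hw
    have h1 := hc w hw.1.le hw.2.le
    rw [huQ w hw, hQ] at h1
    dsimp only at h1
    rw [deriv_const_mul_field, ← h1, div_mul_cancel₀ _ (hg' w hw)]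
  have hconv : Convex ℝ S := (convex_halfSpace_im_gt 0).inter (convex_halfSpace_im_lt 1)
  obtain ⟨k, hk⟩ := isOpen_strip.exists_eq_add_of_deriv_eq hconv.isPreconnected hhd
    (hgd.const_mul (c : ℂ)) hderiv
  refine ⟨c, hc0, k, ?_⟩
  have hcont : ContinuousOn (fun w => (fun w => (c : ℂ) * g w) w + k) {w : ℂ | 0 ≤ w.im ∧ w.im ≤ 1} :=
    (continuousOn_const.mul hgc).add continuousOn_const
  have := hk.of_subset_closure hhc hcont (by rw [← hclS]; exact subset_closure) (by rw [hclS])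
  intro w hw
  exact this hw

end Summit.CriticalPhenomena.CardyFormulaZ2.Theorems.ParafermionFamiliesToSLESix.SCRigidity
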